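import Mathlib
import HarnessLib
import Summits.Ventures.LatticeQCDFlow.Exactness.JarzynskiFinite
import Summits.Ventures.LatticeQCDFlow.Scaling.StochasticFlows

/-!
# The quasi-static dissipation floor of a stepwise switching protocol

HONEST FRAMING: exact (Metropolis-corrected) sampling algorithms for lattice gauge theory;
figures of merit are autocorrelation/cost numbers at stated couplings and volumes; no
continuum-physics claim.

Venture `LatticeQCDFlow` (cell pub-lqcd), topic `Exactness`, FANOUT row 8 (s0-cpn-nemc, GEN-2).
NEW WORK of the cell (elementary finite sums), not a published result: nothing here is cited as a
fact.  It types the statement behind HOME/s0-cpn-nemc/RESULTS.md §7(c): for the non-equilibrium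
(Jarzynski) boundary-condition protocols of Bonanno–Nada–Vadacchino 2024 (2-d CP(N-1), defect
coupling `c : 0 → 1`) and of the cell's 4-d defect flows, the action is LINEAR in the protocol
parameter, `S_c = S₀ + c • D` with `D = ∂S/∂c` supported on the defect, and the protocol switches
`c_k → c_{k+1}` at fixed configuration (work increment `(c_{k+1} - c_k) · D x`) between exact
updates.  If every step starts in equilibrium at `c_k` (the QUASI-STATIC limit: arbitrarily much
relaxation per step), the mean dissipated work of the whole protocol is

  `KL_qs = Σ_k [ (c_{k+1} - c_k) ⟨D⟩_{c_k} - (F(c_{k+1}) - F(c_k)) ]`,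

a left Riemann sum of the antitone function `c ↦ ⟨D⟩_c` minus its "integral" `F(1) - F(0)`.
This file proves, over the tree's finite-configuration vocabulary (`partitionFn`, `gibbsLaw`,
`freeEnergy` of `JarzynskiFinite.lean`; `partitionFn_pos`, `gibbsLaw_pos`, `sum_gibbsLaw` reused from
`Scaling/StochasticFlows.lean`):

* `freeEnergy_sub_le_gibbsMean` — the one-switch second law / Gibbs–Bogoliubov inequality
  `F(T) - F(S) ≤ ⟨T - S⟩_S` (Jensen), the `n = 1`, kernel-free case of `freeEnergy_le_work`;
* `linFreeEnergy_sub_le`, `le_linFreeEnergy_sub` — for the linear family, the secant of `F`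
  between `c` and `c'` is pinched between the two end-point slopes:
  `(c' - c) ⟨D⟩_{c'} ≤ F(c') - F(c) ≤ (c' - c) ⟨D⟩_c` (concavity of `F`, without calculus);
* `meanD_antitone` — hence `c ↦ ⟨D⟩_c` is antitone (`d⟨D⟩/dc = -Var_c D ≤ 0` in words);
* `qsDissipation_nonneg`, `qsDissipation_le` — every quasi-static step dissipates a non-negative
  amount, at most `(c_{k+1} - c_k)(⟨D⟩_{c_k} - ⟨D⟩_{c_{k+1}})`;
* `qsDissipation_uniform_le` — for the uniform grid `c_k = k/n` the total telescopes:
  `0 ≤ KL_qs ≤ (⟨D⟩_0 - ⟨D⟩_1) / n`.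

Dictionary / numbers (OURS, RESULTS §7(c); not proved here): the second-order value of the floor is
HALF the upper bound, `KL_qs = (⟨D⟩_0 - ⟨D⟩_1)/(2 n_step) + O(n_step⁻²)` (trapezoid vs left sum);
at (N, β, L) = (21, 0.7, 114) we measure `⟨D⟩_1 - ⟨D⟩_0 = -24.699(5) · L_d` so
`KL_qs = 12.35 · L_d / n_step`; with Gaussian work (CLT over the steps) the effective-sample-size
estimator is capped at `exp(-2 KL_qs) = exp(-24.70 · L_d / n_step)`, and all 15 composite-unit NE
cells of the S0-D2 reproduction sit 6–29 % above the floor and 1–8 % under that ceiling.  The lower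
bound `0 ≤` is the stepwise second law; that an UNDER-relaxed protocol dissipates MORE than `KL_qs`
is a statement about the dynamics and is not claimed here.
-/

namespace Summit.Ventures.LatticeQCDFlow.Exactness

open Finset
open Summit.Ventures.LatticeQCDFlow.Theory2 (partitionFn_pos gibbsLaw_pos sum_gibbsLaw)

variable {X : Type*} [Fintype X]

/-! ## Gibbs expectations and the one-switch second law -/

/-- Gibbs expectation `⟨f⟩_S = Σ_x (e^{-S x}/Z_S) f x` of an observable under the action `S`. -/
noncomputable def gibbsMean (S : X → ℝ) (f : X → ℝ) : ℝ := ∑ x, gibbsLaw S x * f x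

/-- Reweighting identity behind the one-switch Jarzynski equality:
`Σ_x (e^{-S x}/Z_S) e^{-(T x - S x)} = Z_T / Z_S`. -/
theorem sum_gibbsLaw_mul_exp_neg_sub [Nonempty X] (S T : X → ℝ) :
    ∑ x, gibbsLaw S x * Real.exp (-(T x - S x)) = partitionFn T / partitionFn S := by
  have hterm : ∀ x, gibbsLaw S x * Real.exp (-(T x - S x)) = Real.exp (-T x) / partitionFn S := by
    intro x
    unfold gibbsLaw
    rw [div_mul_eq_mul_div, ← Real.exp_add, show -S x + -(T x - S x) = -T x by ring]
  simp_rw [hterm]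
  rw [← sum_div]
  rfl

/-- **One-switch second law (Gibbs–Bogoliubov / Jensen).**  Switching the action from `S` to `T`
at fixed configuration, drawn from the Gibbs law of `S`, costs on average at least the free-energy
difference: `F T - F S ≤ ⟨T - S⟩_S`.  (The kernel-free `n = 1` case of `freeEnergy_le_work`.) -/
theorem freeEnergy_sub_le_gibbsMean [Nonempty X] (S T : X → ℝ) :
    freeEnergy T - freeEnergy S ≤ gibbsMean S (fun x => T x - S x) := by
  have hj := (convexOn_exp.comp_linearMap (-LinearMap.id : ℝ →ₗ[ℝ] ℝ)).map_sum_le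
    (t := univ) (w := fun x : X => gibbsLaw S x) (p := fun x => T x - S x)
    (fun x _ => (gibbsLaw_pos S x).le) (sum_gibbsLaw S) (fun x _ => Set.mem_univ _)
  simp only [Function.comp, LinearMap.neg_apply, LinearMap.id_apply, smul_eq_mul] at hj
  rw [sum_gibbsLaw_mul_exp_neg_sub S T] at hj
  have hlog := Real.log_le_log (Real.exp_pos _) hj
  rw [Real.log_exp, Real.log_div (partitionFn_pos T).ne' (partitionFn_pos S).ne'] at hlog
  unfold freeEnergy gibbsMean
  linarith

/-! ## The linear family `S_c = S₀ + c • D` -/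

/-- The linear-in-`c` family of actions `S_c x = S₀ x + c * D x` (defect / boundary-coupling
protocols: `D = ∂S/∂c`, supported on the defect links). -/
def linAction (S₀ D : X → ℝ) (c : ℝ) : X → ℝ := fun x => S₀ x + c * D x

/-- `⟨D⟩_c`: the equilibrium expectation of the switch observable at coupling `c`. -/
noncomputable def meanD (S₀ D : X → ℝ) (c : ℝ) : ℝ := gibbsMean (linAction S₀ D c) D

/-- `F(c)`: the free energy of the linear family at coupling `c`. -/
noncomputable def linFreeEnergy (S₀ D : X → ℝ) (c : ℝ) : ℝ := freeEnergy (linAction S₀ D c)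

/-- For the linear family the mean switch cost from `c` to `c'` under the `c`-law is
`(c' - c) ⟨D⟩_c`. -/
theorem gibbsMean_linAction_sub (S₀ D : X → ℝ) (c c' : ℝ) :
    gibbsMean (linAction S₀ D c) (fun x => linAction S₀ D c' x - linAction S₀ D c x)
      = (c' - c) * meanD S₀ D c := by
  unfold meanD gibbsMean linAction
  rw [mul_sum]
  exact sum_congr rfl (fun x _ => by ring)

/-- Upper slope bound: `F(c') - F(c) ≤ (c' - c) ⟨D⟩_c` (the forward one-switch second law). -/
theorem linFreeEnergy_sub_le [Nonempty X] (S₀ D : X → ℝ) (c c' : ℝ) :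
    linFreeEnergy S₀ D c' - linFreeEnergy S₀ D c ≤ (c' - c) * meanD S₀ D c := by
  have h := freeEnergy_sub_le_gibbsMean (linAction S₀ D c) (linAction S₀ D c')
  rw [gibbsMean_linAction_sub] at h
  exact h

/-- Lower slope bound: `(c' - c) ⟨D⟩_{c'} ≤ F(c') - F(c)` (the reverse switch's second law). -/
theorem le_linFreeEnergy_sub [Nonempty X] (S₀ D : X → ℝ) (c c' : ℝ) :
    (c' - c) * meanD S₀ D c' ≤ linFreeEnergy S₀ D c' - linFreeEnergy S₀ D c := by
  have h := linFreeEnergy_sub_le S₀ D c' c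
  linarith

/-- `c ↦ ⟨D⟩_c` is antitone (in words: `d⟨D⟩_c/dc = -Var_c(D) ≤ 0`; here from the two slope
bounds, without calculus). -/
theorem meanD_antitone [Nonempty X] (S₀ D : X → ℝ) : Antitone (meanD S₀ D) := by
  intro c c' hcc'
  rcases eq_or_lt_of_le hcc' with h | h
  · rw [h]
  · have h2 : (c' - c) * meanD S₀ D c' ≤ (c' - c) * meanD S₀ D c :=
      (le_linFreeEnergy_sub S₀ D c c').trans (linFreeEnergy_sub_le S₀ D c c')
    exact le_of_mul_le_mul_left h2 (sub_pos.mpr h)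

/-! ## The quasi-static dissipation of a stepwise protocol -/

/-- Quasi-static (equilibrium-at-every-step) mean dissipated work of the stepwise protocol along
the grid `c 0, c 1, …, c n`:  `Σ_{k<n} [ (c (k+1) - c k) ⟨D⟩_{c k} - (F (c (k+1)) - F (c k)) ]`. -/
noncomputable def qsDissipation (S₀ D : X → ℝ) (c : ℕ → ℝ) (n : ℕ) : ℝ :=
  ∑ k ∈ range n,
    ((c (k + 1) - c k) * meanD S₀ D (c k) - (linFreeEnergy S₀ D (c (k + 1)) - linFreeEnergy S₀ D (c k)))

/-- Every quasi-static step dissipates a non-negative amount (stepwise second law), so the floor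
is non-negative for ANY grid. -/
theorem qsDissipation_nonneg [Nonempty X] (S₀ D : X → ℝ) (c : ℕ → ℝ) (n : ℕ) :
    0 ≤ qsDissipation S₀ D c n :=
  sum_nonneg (fun k _ => by
    have := linFreeEnergy_sub_le S₀ D (c k) (c (k + 1))
    linarith)

/-- Step-by-step upper bound: the `k`-th term is at most
`(c (k+1) - c k) ⟨D⟩_{c k} - (c (k+1) - c k) ⟨D⟩_{c (k+1)}`. -/
theorem qsDissipation_le [Nonempty X] (S₀ D : X → ℝ) (c : ℕ → ℝ) (n : ℕ) :
    qsDissipation S₀ D c n ≤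
      ∑ k ∈ range n,
        ((c (k + 1) - c k) * meanD S₀ D (c k) - (c (k + 1) - c k) * meanD S₀ D (c (k + 1))) :=
  sum_le_sum (fun k _ => by
    have := le_linFreeEnergy_sub S₀ D (c k) (c (k + 1))
    linarith)

/-- **The floor for the uniform linear protocol `c_k = k/n`** (Bonanno–Nada–Vadacchino's
`c(n) = n/n_step`): `KL_qs ≤ (⟨D⟩_0 - ⟨D⟩_1) / n` (telescoping); together with
`qsDissipation_nonneg`, `0 ≤ KL_qs ≤ (⟨D⟩_0 - ⟨D⟩_1)/n`.  The second-order value is half of this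
bound (module docstring). -/
theorem qsDissipation_uniform_le [Nonempty X] (S₀ D : X → ℝ) {n : ℕ} (hn : n ≠ 0) :
    qsDissipation S₀ D (fun k => (k : ℝ) / n) n ≤ (meanD S₀ D 0 - meanD S₀ D 1) / n := by
  have h := qsDissipation_le S₀ D (fun k => (k : ℝ) / n) n
  have hn' : (n : ℝ) ≠ 0 := Nat.cast_ne_zero.mpr hn
  have hstep : ∀ k ∈ range n,
      ((((k + 1 : ℕ) : ℝ) / n - (k : ℝ) / n) * meanD S₀ D ((k : ℝ) / n)
        - (((k + 1 : ℕ) : ℝ) / n - (k : ℝ) / n) * meanD S₀ D (((k + 1 : ℕ) : ℝ) / n))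
        = (1 / (n : ℝ)) * (meanD S₀ D ((k : ℝ) / n) - meanD S₀ D (((k + 1 : ℕ) : ℝ) / n)) := by
    intro k _
    rw [Nat.cast_succ]
    ring
  rw [sum_congr rfl hstep, ← mul_sum, sum_range_sub' (fun k => meanD S₀ D ((k : ℝ) / n)) n] at h
  have h0 : ((0 : ℕ) : ℝ) / (n : ℝ) = 0 := by simp
  have h1 : ((n : ℕ) : ℝ) / (n : ℝ) = 1 := div_self hn'
  simp only [h0, h1] at h
  calc qsDissipation S₀ D (fun k => (k : ℝ) / n) n
      ≤ 1 / (n : ℝ) * (meanD S₀ D 0 - meanD S₀ D 1) := h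
    _ = (meanD S₀ D 0 - meanD S₀ D 1) / n := by ring

end Summit.Ventures.LatticeQCDFlow.Exactness

/-! ## Refinement: finer switching never raises the floor (row 8 GEN-3)

HOME/s0-cpn-nemc/RESULTS.md §8 (GEN-3) tested — and excluded, on 45 published `D_KL` points all
lying at `1.00–1.18 ×` the floor — the hypothesis that the primary's code switches the defect
coupling in finer sub-steps than `1/n_step`.  The mathematical content of that hypothesis class is
typed here: splitting a switch `c → c'` at any intermediate coupling `m` and starting the second
part in equilibrium at `m` LOWERS the quasi-static cost, by exactly `(c' - m)(⟨D⟩_c - ⟨D⟩_m) ≥ 0`;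
hence the uniform `2n`-step protocol dissipates at most what the `n`-step one does (the design
lever of RESULTS §7(b)/(c): at fixed cost, more switches beat more relaxation per switch).  The
second-order statement — that it dissipates HALF as much, `KL_qs = (⟨D⟩_0 - ⟨D⟩_1)/(2n) + O(n⁻²)`
— needs `d⟨D⟩_c/dc = -Var_c D` and is not typed.
-/

namespace Summit.Ventures.LatticeQCDFlow.Exactness

open Finset

variable {X : Type*} [Fintype X]

/-- **Splitting a switch lowers the quasi-static cost.**  For `c ≤ m ≤ c'`:
`[(m - c)⟨D⟩_c - (F m - F c)] + [(c' - m)⟨D⟩_m - (F c' - F m)] ≤ (c' - c)⟨D⟩_c - (F c' - F c)`;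
the two sides differ by `(c' - m)(⟨D⟩_c - ⟨D⟩_m) ≥ 0` (`meanD_antitone`). -/
theorem qsStep_split_le [Nonempty X] (S₀ D : X → ℝ) {c m c' : ℝ} (hcm : c ≤ m) (hmc' : m ≤ c') :
    ((m - c) * meanD S₀ D c - (linFreeEnergy S₀ D m - linFreeEnergy S₀ D c))
      + ((c' - m) * meanD S₀ D m - (linFreeEnergy S₀ D c' - linFreeEnergy S₀ D m))
      ≤ (c' - c) * meanD S₀ D c - (linFreeEnergy S₀ D c' - linFreeEnergy S₀ D c) := by
  have h : (c' - m) * meanD S₀ D m ≤ (c' - m) * meanD S₀ D c :=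
    mul_le_mul_of_nonneg_left (meanD_antitone S₀ D hcm) (sub_nonneg.mpr hmc')
  linarith

/-- Pairing consecutive terms of a sum over `range (2 * n)`. -/
theorem sum_range_two_mul_pair (f : ℕ → ℝ) (n : ℕ) :
    ∑ j ∈ range (2 * n), f j = ∑ k ∈ range n, (f (2 * k) + f (2 * k + 1)) := by
  induction n with
  | zero => simp
  | succ n ih =>
    rw [show 2 * (n + 1) = 2 * n + 1 + 1 by ring, sum_range_succ, sum_range_succ, ih,
      sum_range_succ]
    ring

/-- **Halving the switch never raises the floor.**  For the uniform linear protocol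
(Bonanno–Nada–Vadacchino's `c(n) = n/n_step`) the quasi-static dissipation with `2n` steps is at
most that with `n` steps: `KL_qs(c_k = k/(2n)) ≤ KL_qs(c_k = k/n)`. -/
theorem qsDissipation_uniform_two_mul_le [Nonempty X] (S₀ D : X → ℝ) (n : ℕ) :
    qsDissipation S₀ D (fun k => (k : ℝ) / ((2 * n : ℕ) : ℝ)) (2 * n)
      ≤ qsDissipation S₀ D (fun k => (k : ℝ) / (n : ℝ)) n := by
  unfold qsDissipation
  rw [sum_range_two_mul_pair]
  refine sum_le_sum (fun k hk => ?_)
  have hn : 0 < n := lt_of_le_of_lt (Nat.zero_le k) (mem_range.mp hk)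
  have e1 : ((2 * k : ℕ) : ℝ) / ((2 * n : ℕ) : ℝ) = (k : ℝ) / (n : ℝ) := by
    push_cast
    exact mul_div_mul_left _ _ two_ne_zero
  have e2 : ((2 * k + 1 + 1 : ℕ) : ℝ) / ((2 * n : ℕ) : ℝ) = ((k + 1 : ℕ) : ℝ) / (n : ℝ) := by
    push_cast
    rw [show (2 * (k : ℝ) + 1 + 1) = 2 * ((k : ℝ) + 1) by ring]
    exact mul_div_mul_left _ _ two_ne_zero
  have hpos : (0 : ℝ) < ((2 * n : ℕ) : ℝ) := by positivity
  have hcm : (k : ℝ) / (n : ℝ) ≤ ((2 * k + 1 : ℕ) : ℝ) / ((2 * n : ℕ) : ℝ) := by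
    rw [← e1]
    exact div_le_div_of_nonneg_right (by exact_mod_cast (by omega : 2 * k ≤ 2 * k + 1)) hpos.le
  have hmc' : ((2 * k + 1 : ℕ) : ℝ) / ((2 * n : ℕ) : ℝ) ≤ ((k + 1 : ℕ) : ℝ) / (n : ℝ) := by
    rw [← e2]
    exact div_le_div_of_nonneg_right
      (by exact_mod_cast (by omega : 2 * k + 1 ≤ 2 * k + 1 + 1)) hpos.le
  dsimp only
  rw [e1, e2]
  exact qsStep_split_le S₀ D hcm hmc'

end Summit.Ventures.LatticeQCDFlow.Exactness

/-! ## Note added (row 8 GEN-5): the dynamics statement is now typed for lazy layers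

The module docstring above leaves unclaimed "that an UNDER-relaxed protocol dissipates MORE than
`KL_qs`" (a statement about the dynamics).  For the solvable class of LAZY perfect-relaxation
layers `ε·I + (1 − ε)·Π` this is now a theorem of the tree:
`Exactness/LazyRelaxationLagLaw.lean` proves `⟨W⟩ − ΔF = KL_qs + Σ_j (c_{j+1} − c_j)·e_j` exactly
(`lazyDissipation_eq`, lag `e_{j+1} = ε(e_j + ⟨D⟩_{c_j} − ⟨D⟩_{c_{j+1}})`), hence
`KL_qs ≤ ⟨W⟩ − ΔF` along every monotone grid (`qsDissipation_le_lazyDissipation`) and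
`⟨W⟩ − ΔF ≤ 2τ_int · (⟨D⟩_0 − ⟨D⟩_1)/(2n) + M/(12n²)` on the uniform grid
(`lazyDissipation_uniform_le_tauInt`); `Exactness/LazyRelaxationGranularity{,Witness}.lean` carry
the fixed-sweep-budget refinement of `qsDissipation_uniform_two_mul_le` and its limits.  General
(non-lazy) kernels remain unclaimed.
-/
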